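import Summits.MatrixMultiplication.MatrixMultiplication.Theorems.SubgroupIdentityDesigns.Negative.LevelOneFloor

/-!
# Near-floor volumes: a `(2,1)` triple with `|H₁||H₂||H₃| ≤ (p-1)(p+1)³` only serves `ε > 1 - O(1/(p log p))`

Route `LevelGradedCohnUmans`, crux `SubgroupIdentityDesigns` (stmt-MatrixMultiplication-14079),
negative side, `(m,k) = (2,1)` cell.  The master floor (`LevelOneFloor`) kills every triple of volume
`V ≤ f(3) = 1 + p³ + (p-2)(p+1)³` at every `-2 < ε ≤ 1`.  The order-profile sieve of the cell
(scalar law + pair walls + floor + free vector; report ORACLE-g16 §G16-3) leaves, for `37 ≤ p ≤ 241`,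
ONLY profiles of volume EXACTLY `(p-1)(p+1)³ = f(3) + 3p² + 3p` ("family I": three members in
normalisers of non-split tori, `|Hᵢ| = zᵢ(p+1)`, `z₁z₂z₃ = p-1`; `p = 61, 157, 181, 229, 241`).
This file proves, for ALL primes `p` and with no TPP / design / classification hypothesis, that such
near-floor volumes are useless except for `ε` extremely close to `1`:

* `rpow_le_of_volume_le_familyI` : `V ≤ (p-1)(p+1)³` and `(p-1)^{s/3} ≤ p-2` give
  `V^{s/3} ≤ (p-2)(p+1)^s` (`< 1 + p^s + (p-2)(p+1)^s ≤ budget p 2 1 s`);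
* `no_levelOne_witness_of_volume_le_familyI` : hence the crux inequality
  `budget p 2 1 (2+ε) < V^{(2+ε)/3}` FAILS whenever `(p-1)^{(2+ε)/3} ≤ p - 2`;
* `gap_of_le_logb` : the hypothesis holds iff `(2+ε)/3 ≤ log(p-2)/log(p-1)` (`p ≥ 4`), i.e. for all
  `ε ≤ 1 - 3·log((p-1)/(p-2))/log(p-1) = 1 - O(1/(p log p))`;
* `gap_of_le_sixtyone` : explicitly, for `p ≥ 61` it holds for every `ε ≤ 49/50`
  (`(p-1)/(p-2) ≤ 60/59 ≤ 60^{1/150} ≤ (p-1)^{1/150}`), whence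
  `no_levelOne_witness_familyI_sixtyone` : **for `p ≥ 61` and `-2 < ε ≤ 0.98`, no triple with
  `|H₁||H₂||H₃| ≤ (p-1)(p+1)³` satisfies the level-one crux inequality.**

So the sieve survivors at `p = 61, 157, 181, 229, 241, …` could at best witness `ε ∈ (0.98, 1]`
(numerically `ε > 0.9994` at `p = 61`), far from the `ε → 0` regime the crux needs; whether they carry
level-one identity designs at all is the census question (kit j126920, ORACLE-g16 §G16-5).
VALUE = THEOREM (all `p`), NOT summit progress; the crux item is untouched and remains open.
Report: `run/shared/lean/b2b/levelgraded-cu/ORACLE-g16.md` §G16-6.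
-/

set_option linter.dupNamespace false

noncomputable section

open scoped Classical
open Summit.MatrixMultiplication.MatrixMultiplication.Theorems.LieRankDesigns.Negative (GLm Mat budget)

namespace Summit.MatrixMultiplication.MatrixMultiplication.Theorems.SubgroupIdentityDesigns.Negative

section NearFloor

variable {p : ℕ} [hp : Fact p.Prime]

/-- **Near-floor volume bound.**  If `0 ≤ V ≤ (p-1)(p+1)³`, `0 ≤ s` and `(p-1)^{s/3} ≤ p-2`, then
`V^{s/3} ≤ (p-2)(p+1)^s`. -/
theorem rpow_le_of_volume_le_familyI {V s : ℝ} (hV0 : 0 ≤ V)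
    (hV : V ≤ ((p : ℝ) - 1) * ((p : ℝ) + 1) ^ 3) (hs : 0 ≤ s)
    (hgap : ((p : ℝ) - 1) ^ (s / 3) ≤ (p : ℝ) - 2) :
    V ^ (s / 3) ≤ ((p : ℝ) - 2) * ((p : ℝ) + 1) ^ s := by
  have hp2 : (2 : ℝ) ≤ p := by exact_mod_cast hp.out.two_le
  have h1 : 0 ≤ (p : ℝ) - 1 := by linarith
  have hq : 0 ≤ (p : ℝ) + 1 := by linarith
  have hq3 : 0 ≤ ((p : ℝ) + 1) ^ 3 := pow_nonneg hq 3
  have hs3 : 0 ≤ s / 3 := by positivity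
  calc V ^ (s / 3) ≤ (((p : ℝ) - 1) * ((p : ℝ) + 1) ^ 3) ^ (s / 3) :=
        Real.rpow_le_rpow hV0 hV hs3
    _ = ((p : ℝ) - 1) ^ (s / 3) * (((p : ℝ) + 1) ^ 3) ^ (s / 3) := Real.mul_rpow h1 hq3
    _ = ((p : ℝ) - 1) ^ (s / 3) * ((p : ℝ) + 1) ^ s := by
        congr 1
        rw [← Real.rpow_natCast ((p : ℝ) + 1) 3, ← Real.rpow_mul hq]
        congr 1
        push_cast
        ring
    _ ≤ ((p : ℝ) - 2) * ((p : ℝ) + 1) ^ s :=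
        mul_le_mul_of_nonneg_right hgap (Real.rpow_nonneg hq s)

/-- **NO LEVEL-ONE WITNESS OF NEAR-FLOOR VOLUME** (`GL₂(𝔽_p)`, any prime `p`, any `-2 < ε`):
if `|H₁||H₂||H₃| ≤ (p-1)(p+1)³` (as reals) and `(p-1)^{(2+ε)/3} ≤ p-2`, the crux inequality
`budget p 2 1 (2+ε) < (|H₁||H₂||H₃|)^{(2+ε)/3}` FAILS — no TPP and no identity design needed. -/
theorem no_levelOne_witness_of_volume_le_familyI {ε : ℝ} (hε : -2 < ε)
    {H₁ H₂ H₃ : Subgroup (GLm p 2)}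
    (hV : ((Nat.card H₁ * Nat.card H₂ * Nat.card H₃ : ℕ) : ℝ) ≤ ((p : ℝ) - 1) * ((p : ℝ) + 1) ^ 3)
    (hgap : ((p : ℝ) - 1) ^ ((2 + ε) / 3) ≤ (p : ℝ) - 2) :
    ¬ budget p 2 1 (2 + ε) <
      ((Nat.card H₁ * Nat.card H₂ * Nat.card H₃ : ℕ) : ℝ) ^ ((2 + ε) / 3) := by
  apply not_lt.2
  have h := rpow_le_of_volume_le_familyI (p := p) (Nat.cast_nonneg _) hV (by linarith) hgap
  refine h.trans (le_trans ?_ (budget_two_ge (2 + ε)))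
  have hp0 : (0 : ℝ) ≤ p := Nat.cast_nonneg p
  have : 0 ≤ (p : ℝ) ^ (2 + ε) := Real.rpow_nonneg hp0 _
  linarith

/-- The same with the natural-number hypothesis `|H₁||H₂||H₃| ≤ (p-1)(p+1)³`. -/
theorem no_levelOne_witness_of_volume_le_familyI_nat {ε : ℝ} (hε : -2 < ε)
    {H₁ H₂ H₃ : Subgroup (GLm p 2)}
    (hV : Nat.card H₁ * Nat.card H₂ * Nat.card H₃ ≤ (p - 1) * (p + 1) ^ 3)
    (hgap : ((p : ℝ) - 1) ^ ((2 + ε) / 3) ≤ (p : ℝ) - 2) :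
    ¬ budget p 2 1 (2 + ε) <
      ((Nat.card H₁ * Nat.card H₂ * Nat.card H₃ : ℕ) : ℝ) ^ ((2 + ε) / 3) := by
  refine no_levelOne_witness_of_volume_le_familyI hε ?_ hgap
  have h : ((Nat.card H₁ * Nat.card H₂ * Nat.card H₃ : ℕ) : ℝ) ≤ (((p - 1) * (p + 1) ^ 3 : ℕ) : ℝ) := by
    exact_mod_cast hV
  have e : (((p - 1) * (p + 1) ^ 3 : ℕ) : ℝ) = ((p : ℝ) - 1) * ((p : ℝ) + 1) ^ 3 := by
    push_cast [Nat.cast_sub hp.out.one_le]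
    ring
  rwa [e] at h

omit hp in
/-- The gap hypothesis in logarithmic form (`p ≥ 4`): `s/3 ≤ log_{p-1}(p-2)` gives
`(p-1)^{s/3} ≤ p-2`.  (`log_{p-1}(p-2) = 1 - log((p-1)/(p-2))/log(p-1) = 1 - O(1/(p log p))`.) -/
theorem gap_of_le_logb (hp4 : 4 ≤ p) {s : ℝ}
    (hs : s / 3 ≤ Real.logb ((p : ℝ) - 1) ((p : ℝ) - 2)) :
    ((p : ℝ) - 1) ^ (s / 3) ≤ (p : ℝ) - 2 := by
  have hp4R : (4 : ℝ) ≤ p := by exact_mod_cast hp4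
  have hb1 : 1 < (p : ℝ) - 1 := by linarith
  have hx : 0 < (p : ℝ) - 2 := by linarith
  calc ((p : ℝ) - 1) ^ (s / 3) ≤ ((p : ℝ) - 1) ^ (Real.logb ((p : ℝ) - 1) ((p : ℝ) - 2)) :=
        Real.rpow_le_rpow_of_exponent_le hb1.le hs
    _ = (p : ℝ) - 2 := Real.rpow_logb (by linarith) (ne_of_gt hb1) hx

/-- The numerical constant: `60/59 ≤ 60^{1/150}` (i.e. `60^{149} ≤ 59^{150}`). -/
theorem sixty_div_le_root : (60 : ℝ) / 59 ≤ (60 : ℝ) ^ ((1 : ℝ) / 150) := by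
  have h150 : ((60 : ℝ) / 59) ^ (150 : ℕ) ≤ 60 := by norm_num
  have h0 : (0 : ℝ) ≤ (60 : ℝ) / 59 := by norm_num
  have h := Real.rpow_le_rpow (pow_nonneg h0 150) h150 (show (0 : ℝ) ≤ (1 : ℝ) / 150 by norm_num)
  have e : (((60 : ℝ) / 59) ^ (150 : ℕ)) ^ ((1 : ℝ) / 150) = (60 : ℝ) / 59 := by
    rw [← Real.rpow_natCast, ← Real.rpow_mul h0]
    norm_num
  rwa [e] at h

omit hp in
/-- **Explicit gap for `p ≥ 61`:** `(p-1)^{s/3} ≤ p-2` for every `0 ≤ s ≤ 149/50 = 2.98`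
(`(p-1)^{s/3} ≤ (p-1)^{149/150} = (p-1)/(p-1)^{1/150}` and
`(p-1)^{1/150} ≥ 60^{1/150} ≥ 60/59 ≥ (p-1)/(p-2)`). -/
theorem gap_of_le_sixtyone (hp61 : 61 ≤ p) {s : ℝ} (hs : s ≤ 149 / 50) :
    ((p : ℝ) - 1) ^ (s / 3) ≤ (p : ℝ) - 2 := by
  have hpR : (61 : ℝ) ≤ p := by exact_mod_cast hp61
  set x : ℝ := (p : ℝ) - 1 with hx
  have hx60 : (60 : ℝ) ≤ x := by rw [hx]; linarith
  have hx0 : 0 < x := by linarith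
  have hx1 : 1 ≤ x := by linarith
  -- r = x^{1/150} ≥ x/(x-1)
  have hr : x / (x - 1) ≤ x ^ ((1 : ℝ) / 150) := by
    have h1 : x / (x - 1) ≤ (60 : ℝ) / 59 := by
      rw [div_le_iff₀ (by linarith)]
      linarith
    have h2 : (60 : ℝ) ^ ((1 : ℝ) / 150) ≤ x ^ ((1 : ℝ) / 150) :=
      Real.rpow_le_rpow (by norm_num) hx60 (by norm_num)
    exact h1.trans (sixty_div_le_root.trans h2)
  have hrpos : 0 < x ^ ((1 : ℝ) / 150) := Real.rpow_pos_of_pos hx0 _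
  -- x^{s/3} ≤ x^{149/150} = x / x^{1/150} ≤ x - 1
  have e1 : (p : ℝ) - 2 = x - 1 := by rw [hx]; ring
  rw [e1]
  calc x ^ (s / 3) ≤ x ^ ((1 : ℝ) - (1 : ℝ) / 150) :=
        Real.rpow_le_rpow_of_exponent_le hx1 (by linarith)
    _ = x ^ (1 : ℝ) / x ^ ((1 : ℝ) / 150) := Real.rpow_sub hx0 _ _
    _ = x / x ^ ((1 : ℝ) / 150) := by rw [Real.rpow_one]
    _ ≤ x - 1 := by
        rw [div_le_iff₀ hrpos]
        have h3 : x ≤ x ^ ((1 : ℝ) / 150) * (x - 1) := (div_le_iff₀ (by linarith)).mp hr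
        linarith

/-- **FAMILY-I CEILING, EXPLICIT (all primes `p ≥ 61`, all `-2 < ε ≤ 0.98`).**  No triple
`H₁, H₂, H₃ ≤ GL₂(𝔽_p)` with `|H₁||H₂||H₃| ≤ (p-1)(p+1)³` satisfies the level-one crux inequality
`budget p 2 1 (2+ε) < (|H₁||H₂||H₃|)^{(2+ε)/3}`.  In particular the order-sieve survivors of the
`(2,1)` cell at `p = 61, 157, 181, 229, 241` (volume exactly `(p-1)(p+1)³`) can witness the crux for
NO `ε ≤ 0.98`. -/
theorem no_levelOne_witness_familyI_sixtyone (hp61 : 61 ≤ p) {ε : ℝ} (hε : -2 < ε)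
    (hε1 : ε ≤ 49 / 50) {H₁ H₂ H₃ : Subgroup (GLm p 2)}
    (hV : Nat.card H₁ * Nat.card H₂ * Nat.card H₃ ≤ (p - 1) * (p + 1) ^ 3) :
    ¬ budget p 2 1 (2 + ε) <
      ((Nat.card H₁ * Nat.card H₂ * Nat.card H₃ : ℕ) : ℝ) ^ ((2 + ε) / 3) :=
  no_levelOne_witness_of_volume_le_familyI_nat hε hV
    (gap_of_le_sixtyone hp61 (s := 2 + ε) (by linarith))

end NearFloor

end Summit.MatrixMultiplication.MatrixMultiplication.Theorems.SubgroupIdentityDesigns.Negative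

end
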